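import Mathlib
import Literature.Probability.Percolation.DiagonalStripVertexNumerators
import HarnessLib

/-!
# The special component of Hagendorf–Liénardy's vector (HL Prop. 3.1)

Topic `Literature/Probability/Percolation`. For the packed configuration `a⁰ = (0, 1, …, n-1)` (down
spins at the first `n` sites) only the pole assignment `w_ℓ = z_ℓ` contributes to the residue sum
defining `Ψ_{a⁰}` ("the only pole that contributes to the contour integral with respect to `w_ℓ` is
`z_ℓ`", HL Prop. 3.1), and the single surviving term simplifies to the closed form (HL (3.5) at
`β → 0`, normalised by `βⁿ`, sites `0, …, L-1`, `c = q`)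

`Ψ_{a⁰} = (-1)ⁿ ∏_{k<k'<n} [c z_{k'}/z_k][c z_k z_{k'}] ∏_{k<n} z_k⁻¹ ∏_{n≤i<j<L} [c z_j/z_i][c² z_i z_j]`

(**`vPsi_spec`**). Consequences: the special component is not zero (**`vPsi_spec_ne_zero`**) and, when
the last site is up (`n < L`), it is invariant under `z_{L} ↦ 1/z_{L}` (**`genInv_vPsi_spec`**, the input
of HL's proof of the right reflection relation, Prop. 3.7 Case 1, at `s = 1`, `q³ = 1`).

## References

* C. Hagendorf, J. Liénardy, *The open XXZ chain at Δ = -1/2 and the boundary quantum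
  Knizhnik–Zamolodchikov equations*, J. Stat. Mech. (2021) 013104, arXiv:2008.03220, Prop. 3.1,
  (3.5), Prop. 3.7. [HagendorfLienardy2021]
-/

noncomputable section

namespace Literature.Probability.Percolation

open Finset MvPolynomial Literature.Probability.LatticeModels.TemperleyLieb

variable {L n : ℕ}

/-! ### Only the identity pole assignment survives -/

section SingleTerm

variable (q : ℂ)

/-- An injective assignment `J` of poles with `J ℓ ≤ ℓ` for all `ℓ` is the identity. [folklore] -/
theorem embedding_eq_castLE_of_le (h : n ≤ L) (J : Fin n ↪ Fin L) (hle : ∀ ℓ, (J ℓ).val ≤ ℓ.val) :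
    J = Fin.castLEEmb h := by
  have key : ∀ k : ℕ, ∀ ℓ : Fin n, ℓ.val = k → (J ℓ).val = ℓ.val := by
    intro k
    induction k using Nat.strong_induction_on with
    | _ k ih =>
      intro ℓ hℓ
      rcases (hle ℓ).lt_or_eq with hlt | heq
      · exfalso
        set ℓ' : Fin n := ⟨(J ℓ).val, by omega⟩ with hℓ'
        have h1 : (J ℓ').val = (J ℓ).val := ih (J ℓ).val (by omega) ℓ' rfl
        have h2 : ℓ' = ℓ := J.injective (Fin.ext h1)
        have : (ℓ' : ℕ) = ℓ := by rw [h2]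
        simp only [hℓ'] at this; omega
      · exact heq
  ext ℓ
  simp only [Fin.castLEEmb_apply, Fin.val_castLE]
  exact key ℓ.val ℓ rfl

/-- **Only `w = (z_0, …, z_{n-1})` contributes**: at every other pole assignment the numerator of the
packed configuration vanishes (a factor `[z_j/z_j] = 0` with `j = J ℓ > ℓ`).
[cite: HagendorfLienardy2021, Prop. 3.1] -/
theorem vNum_spec_eq_zero (h : n ≤ L) {J : Fin n ↪ Fin L} (hJ : J ≠ Fin.castLEEmb h) :
    vNum q zv (Fin.castLE h) (fun ℓ => zv (J ℓ)) = 0 := by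
  obtain ⟨ℓ, hℓ⟩ : ∃ ℓ : Fin n, ℓ.val < (J ℓ).val := by
    by_contra hcon
    push Not at hcon
    exact hJ (embedding_eq_castLE_of_le h J hcon)
  unfold vNum
  refine mul_eq_zero_of_right _ (mul_eq_zero_of_left ?_ _)
  refine prod_eq_zero (mem_univ ℓ) ?_
  unfold eT
  refine mul_eq_zero_of_left (prod_eq_zero (i := J ℓ) ?_ ?_) _
  · simp only [mem_filter, mem_univ, true_and, Fin.lt_def, Fin.val_castLE]; exact hℓ
  · rw [div_self (zv_ne_zero _), qbr_one]

/-- **The special component is a single residue term.** [cite: HagendorfLienardy2021, Prop. 3.1] -/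
theorem vPsi_spec_eq_single (h : n ≤ L) :
    vPsi q L n (Fin.castLE h) = qbr (genC ℂ q) ^ n * pref q (zv (L := L)) *
      (vNum q zv (Fin.castLE h) (fun ℓ => zv (Fin.castLE h ℓ)) * ∏ ℓ, resWeight L (Fin.castLE h ℓ)) := by
  unfold vPsi
  rw [resSum_eq_single (vNum q zv (Fin.castLE h)) (Fin.castLEEmb h) fun J hJ => vNum_spec_eq_zero q h hJ]
  rfl

end SingleTerm

/-! ### Site-indexed form of the single term -/

section Sites

variable (q : ℂ)

/-- The first `n` sites. [folklore] -/
def sLT (L n : ℕ) : Finset (Fin L) := univ.filter fun i : Fin L => i.val < n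

/-- Membership in `sLT`. [folklore] -/
@[simp] theorem mem_sLT {i : Fin L} : i ∈ sLT L n ↔ i.val < n := by simp [sLT]

/-- The first `n` sites are the image of `Fin n`. [folklore] -/
theorem map_castLEEmb_eq_sLT (h : n ≤ L) : univ.map (Fin.castLEEmb h) = sLT L n := by
  ext i
  simp only [mem_map, mem_univ, true_and, Fin.castLEEmb_apply, mem_sLT]
  constructor
  · rintro ⟨k, rfl⟩; exact k.isLt
  · intro hi; exact ⟨⟨i.val, hi⟩, Fin.ext rfl⟩

/-- Reindexing a product over labels as a product over the first `n` sites. [folklore] -/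
theorem prod_castLE_eq_prod_sLT {M : Type*} [CommMonoid M] (h : n ≤ L) (f : Fin L → M) :
    ∏ k : Fin n, f (Fin.castLE h k) = ∏ i ∈ sLT L n, f i := by
  rw [← map_castLEEmb_eq_sLT h, prod_map]; rfl

/-- The ordered pairs of sites among the first `n`. [folklore] -/
theorem image_castLE_pairsLT (h : n ≤ L) :
    (pairsLT n).image (fun p => (Fin.castLE h p.1, Fin.castLE h p.2)) = (pairsLT L).filter (fun p => p.2.val < n) := by
  ext ⟨i, j⟩
  simp only [mem_image, mem_pairsLT, mem_filter, Prod.mk.injEq, Fin.lt_def]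
  constructor
  · rintro ⟨⟨k, k'⟩, hkk, rfl, rfl⟩
    simp only [Fin.val_castLE]
    exact ⟨hkk, k'.isLt⟩
  · rintro ⟨hij, hj⟩
    exact ⟨(⟨i.val, by omega⟩, ⟨j.val, hj⟩), hij, Fin.ext rfl, Fin.ext rfl⟩

/-- Reindexing a product over pairs of labels as a product over pairs of sites. [folklore] -/
theorem prod_pairsLT_castLE {M : Type*} [CommMonoid M] (h : n ≤ L) (g : Fin L → Fin L → M) :
    ∏ p ∈ pairsLT n, g (Fin.castLE h p.1) (Fin.castLE h p.2) = ∏ p ∈ (pairsLT L).filter (fun p => p.2.val < n), g p.1 p.2 := by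
  rw [← image_castLE_pairsLT h, prod_image]
  rintro ⟨a, b⟩ _ ⟨a', b'⟩ _ hh
  simp only [Prod.mk.injEq] at hh ⊢
  exact ⟨Fin.castLE_injective h hh.1, Fin.castLE_injective h hh.2⟩

/-- `A` at the first `n` rapidities, site-indexed. [folklore] -/
theorem aFac_spec (h : n ≤ L) :
    aFac q (fun ℓ => zv (Fin.castLE h ℓ)) =
      (∏ p ∈ (pairsLT L).filter (fun p => p.2.val < n), aPair q (zv p.1) (zv p.2)) *
        ∏ i ∈ sLT L n, (qbr (genC ℂ q ^ 2 * zv i * zv i) * (zv i)⁻¹) := by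
  unfold aFac
  rw [prod_pairsLT_castLE h (fun i j => aPair q (zv i) (zv j)), ← prod_mul_distrib,
    prod_castLE_eq_prod_sLT h (fun i => qbr (genC ℂ q ^ 2 * zv i * zv i) * (zv i)⁻¹)]

/-- **The single term, site-indexed.** [folklore] -/
theorem specTerm_eq (h : n ≤ L) :
    vNum q zv (Fin.castLE h) (fun ℓ => zv (Fin.castLE h ℓ)) * ∏ ℓ, resWeight L (Fin.castLE h ℓ) =
      ((∏ p ∈ (pairsLT L).filter (fun p => p.2.val < n), aPair q (zv p.1) (zv p.2)) *
        ∏ i ∈ sLT L n, (qbr (genC ℂ q ^ 2 * zv i * zv i) * (zv i)⁻¹)) *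
      ((∏ i ∈ sLT L n, eT q zv i (zv i)) * (∏ i ∈ sLT L n, gFac q (zv : Fin L → RapidityField ℂ) (zv i)) * ∏ i ∈ sLT L n, resWeight L i) := by
  unfold vNum
  rw [aFac_spec q h, prod_castLE_eq_prod_sLT h (fun i => eT q zv i (zv i)),
    prod_castLE_eq_prod_sLT h (fun i => gFac q (zv : Fin L → RapidityField ℂ) (zv i)), prod_castLE_eq_prod_sLT h (fun i => resWeight L i)]
  ring

end Sites

/-! ### Splitting products of sites at one site -/

section Split

variable {M : Type*} [CommMonoid M]

/-- `∏_{j ≠ ν} = ∏_{j < ν} · ∏_{j > ν}`. [folklore] -/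
theorem prod_erase_eq_prod_lt_mul_prod_gt (ν : Fin L) (f : Fin L → M) :
    ∏ j ∈ univ.erase ν, f j = (∏ j ∈ univ.filter (fun j => j < ν), f j) * ∏ j ∈ univ.filter (fun j => ν < j), f j := by
  have h1 : univ.filter (fun j => j < ν) = (univ.erase ν).filter (fun j => j < ν) := by
    ext j; simp only [mem_filter, mem_univ, true_and, mem_erase, and_true]
    exact ⟨fun h => ⟨ne_of_lt h, h⟩, fun h => h.2⟩
  have h2 : univ.filter (fun j => ν < j) = (univ.erase ν).filter (fun j => ¬j < ν) := by
    ext j; simp only [mem_filter, mem_univ, true_and, mem_erase, not_lt, and_true]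
    exact ⟨fun h => ⟨ne_of_gt h, le_of_lt h⟩, fun h => lt_of_le_of_ne h.2 (Ne.symm h.1)⟩
  rw [h1, h2, prod_filter_mul_prod_filter_not]

/-- `∏_j = ∏_{j < ν} · f ν · ∏_{j > ν}`. [folklore] -/
theorem prod_eq_prod_lt_mul_mul_prod_gt (ν : Fin L) (f : Fin L → M) :
    ∏ j, f j = (∏ j ∈ univ.filter (fun j => j < ν), f j) * f ν * ∏ j ∈ univ.filter (fun j => ν < j), f j := by
  rw [← mul_prod_erase _ _ (mem_univ ν), prod_erase_eq_prod_lt_mul_prod_gt]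
  ac_rfl

/-- The sites below `ν = n` are the first `n` sites. [folklore] -/
theorem filter_lt_eq_sLT (ν : Fin L) : univ.filter (fun j => j < ν) = sLT L ν.val := by
  ext j; simp only [mem_filter, mem_univ, true_and, mem_sLT, Fin.lt_def]

/-- `sLT (n+1) = insert n (sLT n)`. [folklore] -/
theorem sLT_succ (hn : n < L) : sLT L (n + 1) = insert ⟨n, hn⟩ (sLT L n) := by
  ext j
  simp only [mem_sLT, mem_insert, Fin.ext_iff]
  omega

/-- `n ∉ sLT n`. [folklore] -/
theorem not_mem_sLT_self (hn : n < L) : (⟨n, hn⟩ : Fin L) ∉ sLT L n := by simp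

/-- `ν ∉ sLT ν`. [folklore] -/
theorem not_mem_sLT_val (ν : Fin L) : ν ∉ sLT L ν.val := by simp

/-- The pairs with second site `< n+1`: those with second site `< n` and the pairs `(i, n)`, `i < n`. [folklore] -/
theorem filter_snd_lt_succ (hn : n < L) :
    (pairsLT L).filter (fun p => p.2.val < n + 1) =
      (pairsLT L).filter (fun p => p.2.val < n) ∪ (sLT L n).image (fun i => (i, (⟨n, hn⟩ : Fin L))) := by
  ext ⟨i, j⟩
  simp only [mem_filter, mem_pairsLT, mem_union, mem_image, mem_sLT, Prod.mk.injEq, Fin.lt_def]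
  constructor
  · rintro ⟨hij, hj⟩
    by_cases hjn : j.val < n
    · exact Or.inl ⟨hij, hjn⟩
    · have : j = ⟨n, hn⟩ := Fin.ext (by simp; omega)
      subst this
      exact Or.inr ⟨i, hij, rfl, rfl⟩
  · rintro (⟨hij, hj⟩ | ⟨k, hk, rfl, rfl⟩)
    · exact ⟨hij, by omega⟩
    · exact ⟨hk, by simp⟩

/-- The two parts are disjoint. [folklore] -/
theorem disjoint_filter_snd_lt_image (hn : n < L) :
    Disjoint ((pairsLT L).filter (fun p => p.2.val < n)) ((sLT L n).image (fun i => (i, (⟨n, hn⟩ : Fin L)))) := by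
  rw [disjoint_left]
  rintro ⟨i, j⟩ h1 h2
  simp only [mem_filter, mem_pairsLT] at h1
  simp only [mem_image, Prod.mk.injEq] at h2
  obtain ⟨k, _, _, rfl⟩ := h2
  exact lt_irrefl _ h1.2

/-- The pairs with first site `< n+1`: those with first site `< n` and the pairs `(n, j)`, `j > n`. [folklore] -/
theorem filter_fst_lt_succ (hn : n < L) :
    (pairsLT L).filter (fun p => p.1.val < n + 1) =
      (pairsLT L).filter (fun p => p.1.val < n) ∪ (univ.filter (fun j => (⟨n, hn⟩ : Fin L) < j)).image (fun j => ((⟨n, hn⟩ : Fin L), j)) := by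
  ext ⟨i, j⟩
  simp only [mem_filter, mem_pairsLT, mem_union, mem_image, mem_univ, true_and, Prod.mk.injEq, Fin.lt_def]
  constructor
  · rintro ⟨hij, hi⟩
    by_cases hin : i.val < n
    · exact Or.inl ⟨hij, hin⟩
    · have : i = ⟨n, hn⟩ := Fin.ext (by simp; omega)
      subst this
      exact Or.inr ⟨j, hij, rfl, rfl⟩
  · rintro (⟨hij, hi⟩ | ⟨k, hk, rfl, rfl⟩)
    · exact ⟨hij, by omega⟩
    · exact ⟨hk, by simp⟩

/-- The two parts are disjoint. [folklore] -/
theorem disjoint_filter_fst_lt_image (hn : n < L) :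
    Disjoint ((pairsLT L).filter (fun p => p.1.val < n))
      ((univ.filter (fun j => (⟨n, hn⟩ : Fin L) < j)).image (fun j => ((⟨n, hn⟩ : Fin L), j))) := by
  rw [disjoint_left]
  rintro ⟨i, j⟩ h1 h2
  simp only [mem_filter, mem_pairsLT] at h1
  simp only [mem_image, mem_filter, mem_univ, true_and, Prod.mk.injEq] at h2
  obtain ⟨k, _, rfl, rfl⟩ := h2
  exact lt_irrefl _ h1.2

/-- Product over the pairs with second site `< n+1`. [folklore] -/
theorem prod_filter_snd_lt_succ (hn : n < L) (g : Fin L → Fin L → M) :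
    ∏ p ∈ (pairsLT L).filter (fun p => p.2.val < n + 1), g p.1 p.2 =
      (∏ p ∈ (pairsLT L).filter (fun p => p.2.val < n), g p.1 p.2) * ∏ i ∈ sLT L n, g i ⟨n, hn⟩ := by
  rw [filter_snd_lt_succ hn, prod_union (disjoint_filter_snd_lt_image hn), prod_image]
  rintro a _ b _ hh; simpa using hh

/-- Product over the pairs with first site `< n+1`. [folklore] -/
theorem prod_filter_fst_lt_succ (hn : n < L) (g : Fin L → Fin L → M) :
    ∏ p ∈ (pairsLT L).filter (fun p => p.1.val < n + 1), g p.1 p.2 =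
      (∏ p ∈ (pairsLT L).filter (fun p => p.1.val < n), g p.1 p.2) *
        ∏ j ∈ univ.filter (fun j => (⟨n, hn⟩ : Fin L) < j), g ⟨n, hn⟩ j := by
  rw [filter_fst_lt_succ hn, prod_union (disjoint_filter_fst_lt_image hn), prod_image]
  rintro a _ b _ hh; simpa using hh

end Split

/-! ### The closed form -/

section Closed

variable (q : ℂ)

/-- The left-hand side of the inductive identity: `[c]ⁿ × (site-indexed single term) × (the pairs of
the prefactor with first site `< n`)`. [folklore] -/
def specLHS (L n : ℕ) : RapidityField ℂ :=
  qbr (genC ℂ q) ^ n *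
    (((∏ p ∈ (pairsLT L).filter (fun p => p.2.val < n), aPair q (zv p.1) (zv p.2)) *
        ∏ i ∈ sLT L n, (qbr (genC ℂ q ^ 2 * zv i * zv i) * (zv i)⁻¹)) *
      ((∏ i ∈ sLT L n, eT q zv i (zv i)) * (∏ i ∈ sLT L n, gFac q (zv : Fin L → RapidityField ℂ) (zv i)) * ∏ i ∈ sLT L n, resWeight L i)) *
    ∏ p ∈ (pairsLT L).filter (fun p => p.1.val < n), qbr (genC ℂ q * zv p.2 / zv p.1) * qbr (genC ℂ q ^ 2 * zv p.1 * zv p.2)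

/-- The right-hand side: `(-1)ⁿ ∏_{i<j<n} [c z_j/z_i][c z_i z_j] ∏_{i<n} z_i⁻¹`. [folklore] -/
def specRHS (L n : ℕ) : RapidityField ℂ :=
  (-1) ^ n * (∏ p ∈ (pairsLT L).filter (fun p => p.2.val < n), qbr (genC ℂ q * zv p.2 / zv p.1) * qbr (genC ℂ q * zv p.1 * zv p.2)) *
    ∏ i ∈ sLT L n, (zv i)⁻¹

variable {q} (hq : q ^ 2 + q + 1 = 0)
include hq

omit hq in
/-- The cancellation pattern of the inductive step, as an identity in a field. [folklore] -/
theorem spec_step_identity {F : Type*} [Field F] {qc d z P₁ P₂ Q₁ Q₂ S₁ S₂ U₁ V₁ : F} (hqc : qc ≠ 0) (hd : d ≠ 0)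
    (hz : z ≠ 0) (hP₁ : P₁ ≠ 0) (hP₂ : P₂ ≠ 0) (hQ₁ : Q₁ ≠ 0) (hQ₂ : Q₂ ≠ 0) (hS₁ : S₁ ≠ 0) (hS₂ : S₂ ≠ 0) :
    qc * (U₁ * P₁ * V₁ * S₁) * (d * z⁻¹) * (P₂ * Q₁) * (Q₁ * qc * Q₂ * (S₁ * d * S₂))⁻¹ * (-(P₁ * P₂)⁻¹) * (Q₂ * S₂) =
      -(U₁ * V₁) * z⁻¹ := by
  field_simp

/-- **The inductive step**: the factors of the new site `ν = n` cancel down to `-∏_{i<n} [c z_n/z_i][c z_i z_n] · z_n⁻¹`.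
[cite: HagendorfLienardy2021, Prop. 3.1] -/
theorem spec_step (ν : Fin L) :
    qbr (genC ℂ q) * (∏ i ∈ sLT L ν.val, aPair q (zv i) (zv ν)) * (qbr (genC ℂ q ^ 2 * zv ν * zv ν) * (zv ν)⁻¹) *
        eT q zv ν (zv ν) * gFac q (zv : Fin L → RapidityField ℂ) (zv ν) * resWeight L ν *
      ∏ j ∈ univ.filter (fun j => ν < j), qbr (genC ℂ q * zv j / zv ν) * qbr (genC ℂ q ^ 2 * zv ν * zv j) =
    -(∏ i ∈ sLT L ν.val, qbr (genC ℂ q * zv ν / zv i) * qbr (genC ℂ q * zv i * zv ν)) * (zv ν)⁻¹ := by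
  have hA : ∏ i ∈ sLT L ν.val, aPair q (zv i) (zv ν) =
      (∏ i ∈ sLT L ν.val, qbr (genC ℂ q * zv ν / zv i)) * (∏ i ∈ sLT L ν.val, qbr (zv i / zv ν)) *
        (∏ i ∈ sLT L ν.val, qbr (genC ℂ q * zv i * zv ν)) * ∏ i ∈ sLT L ν.val, qbr (genC ℂ q ^ 2 * zv i * zv ν) := by
    simp only [aPair, prod_mul_distrib]
  have hE : eT q zv ν (zv ν) = (∏ j ∈ univ.filter (fun j => ν < j), qbr (zv j / zv ν)) *
      ∏ i ∈ sLT L ν.val, qbr (genC ℂ q * zv i / zv ν) := by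
    unfold eT; rw [filter_lt_eq_sLT]
  have hG : gFac q (zv : Fin L → RapidityField ℂ) (zv ν) =
      ((∏ i ∈ sLT L ν.val, qbr (genC ℂ q * zv i / zv ν)) * qbr (genC ℂ q) *
          (∏ j ∈ univ.filter (fun j => ν < j), qbr (genC ℂ q * zv j / zv ν)) *
        ((∏ i ∈ sLT L ν.val, qbr (genC ℂ q ^ 2 * zv i * zv ν)) * qbr (genC ℂ q ^ 2 * zv ν * zv ν) *
          ∏ j ∈ univ.filter (fun j => ν < j), qbr (genC ℂ q ^ 2 * zv ν * zv j)))⁻¹ := by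
    unfold gFac
    rw [prod_eq_prod_lt_mul_mul_prod_gt ν (fun j => qbr (genC ℂ q * zv j / zv ν)),
      prod_eq_prod_lt_mul_mul_prod_gt ν (fun j => qbr (genC ℂ q ^ 2 * zv ν * zv j)), filter_lt_eq_sLT]
    have hcc : qbr (genC ℂ q * zv ν / zv ν) = qbr (genC ℂ q) := by rw [mul_div_assoc, div_self (zv_ne_zero ν), mul_one]
    have hS : ∏ i ∈ sLT L ν.val, qbr (genC ℂ q ^ 2 * zv ν * zv i) = ∏ i ∈ sLT L ν.val, qbr (genC ℂ q ^ 2 * zv i * zv ν) :=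
      prod_congr rfl fun i _ => by ring_nf
    rw [hcc, hS]
  have hR : resWeight L ν = -((∏ i ∈ sLT L ν.val, qbr (zv i / zv ν)) * ∏ j ∈ univ.filter (fun j => ν < j), qbr (zv j / zv ν))⁻¹ := by
    unfold resWeight; rw [prod_erase_eq_prod_lt_mul_prod_gt, filter_lt_eq_sLT]
  rw [hA, hE, hG, hR, prod_mul_distrib, prod_mul_distrib]
  refine spec_step_identity (qbr_genC_ne_zero hq) (qbr_genC_sq_zv_mul_ne_zero hq ν ν) (zv_ne_zero ν) ?_ ?_ ?_ ?_ ?_ ?_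
  · exact prod_ne_zero_iff.2 fun i hi => qbr_zv_div_ne_zero (fun h => by rw [h] at hi; exact not_mem_sLT_val ν hi)
  · exact prod_ne_zero_iff.2 fun j hj => qbr_zv_div_ne_zero (fun h => by rw [h] at hj; simp at hj)
  · exact prod_ne_zero_iff.2 fun i _ => qbr_genC_zv_div_ne_zero hq i ν
  · exact prod_ne_zero_iff.2 fun j _ => qbr_genC_zv_div_ne_zero hq j ν
  · exact prod_ne_zero_iff.2 fun i _ => qbr_genC_sq_zv_mul_ne_zero hq i ν
  · exact prod_ne_zero_iff.2 fun j _ => qbr_genC_sq_zv_mul_ne_zero hq ν j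

/-- **The closed form of the single term** (induction on the number of down spins).
[cite: HagendorfLienardy2021, Prop. 3.1, (3.5)] -/
theorem specLHS_eq_specRHS : ∀ n, n ≤ L → specLHS q L n = specRHS q L n := by
  intro n
  induction n with
  | zero =>
    intro _
    unfold specLHS specRHS
    have h3 : sLT L 0 = ∅ := by ext i; simp
    simp [h3]
  | succ n ih =>
    intro hn
    have hn' : n < L := by omega
    have ih' := ih hn'.le
    unfold specLHS specRHS at ih' ⊢
    rw [prod_filter_snd_lt_succ hn' (fun i j => aPair q (zv i) (zv j)), sLT_succ hn',
      prod_insert (not_mem_sLT_self hn'), prod_insert (not_mem_sLT_self hn'), prod_insert (not_mem_sLT_self hn'),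
      prod_insert (not_mem_sLT_self hn'), prod_insert (not_mem_sLT_self hn'),
      prod_filter_fst_lt_succ hn' (fun i j => qbr (genC ℂ q * zv j / zv i) * qbr (genC ℂ q ^ 2 * zv i * zv j)),
      prod_filter_snd_lt_succ hn' (fun i j => qbr (genC ℂ q * zv j / zv i) * qbr (genC ℂ q * zv i * zv j))]
    have step := spec_step hq (⟨n, hn'⟩ : Fin L)
    rw [show qbr (genC ℂ q) ^ (n + 1) = qbr (genC ℂ q) ^ n * qbr (genC ℂ q) from pow_succ _ _,
      show ((-1 : RapidityField ℂ)) ^ (n + 1) = (-1) ^ n * (-1) from pow_succ _ _]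
    linear_combination (qbr (genC ℂ q) ^ n * ((∏ p ∈ (pairsLT L).filter (fun p => p.2.val < n), aPair q (zv p.1) (zv p.2)) *
        ∏ i ∈ sLT L n, (qbr (genC ℂ q ^ 2 * zv i * zv i) * (zv i)⁻¹)) *
      ((∏ i ∈ sLT L n, eT q zv i (zv i)) * (∏ i ∈ sLT L n, gFac q (zv : Fin L → RapidityField ℂ) (zv i)) * ∏ i ∈ sLT L n, resWeight L i) *
      ∏ p ∈ (pairsLT L).filter (fun p => p.1.val < n), qbr (genC ℂ q * zv p.2 / zv p.1) * qbr (genC ℂ q ^ 2 * zv p.1 * zv p.2)) * step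
      + ((-1) * (∏ i ∈ sLT L n, qbr (genC ℂ q * zv (⟨n, hn'⟩ : Fin L) / zv i) * qbr (genC ℂ q * zv i * zv (⟨n, hn'⟩ : Fin L))) *
        (zv (⟨n, hn'⟩ : Fin L))⁻¹) * ih'

/-- **The closed form of the special component** (HL (3.5) at `β → 0`):
`Ψ_{a⁰} = (-1)ⁿ ∏_{i<j<n} [c z_j/z_i][c z_i z_j] ∏_{i<n} z_i⁻¹ ∏_{n≤i<j} [c z_j/z_i][c² z_i z_j]`.
[cite: HagendorfLienardy2021, Prop. 3.1, (3.5)] -/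
theorem vPsi_spec (h : n ≤ L) :
    vPsi q L n (Fin.castLE h) = specRHS q L n *
      ∏ p ∈ (pairsLT L).filter (fun p => ¬p.1.val < n), qbr (genC ℂ q * zv p.2 / zv p.1) * qbr (genC ℂ q ^ 2 * zv p.1 * zv p.2) := by
  rw [vPsi_spec_eq_single, specTerm_eq, ← specLHS_eq_specRHS hq n h]
  unfold specLHS pref
  rw [← prod_filter_mul_prod_filter_not (pairsLT L) (fun p => p.1.val < n)]
  ring

/-- **The special component does not vanish.** [cite: HagendorfLienardy2021, Prop. 3.1] -/
theorem vPsi_spec_ne_zero (h : n ≤ L) : vPsi q L n (Fin.castLE h) ≠ 0 := by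
  rw [vPsi_spec hq h]
  unfold specRHS
  refine mul_ne_zero (mul_ne_zero (mul_ne_zero (pow_ne_zero _ (neg_ne_zero.2 one_ne_zero)) ?_) ?_) ?_
  · exact prod_ne_zero_iff.2 fun p _ => mul_ne_zero (qbr_genC_zv_div_ne_zero hq _ _) (qbr_genC_zv_mul_ne_zero hq _ _)
  · exact prod_ne_zero_iff.2 fun i _ => inv_ne_zero (zv_ne_zero _)
  · exact prod_ne_zero_iff.2 fun p _ => mul_ne_zero (qbr_genC_zv_div_ne_zero hq _ _) (qbr_genC_sq_zv_mul_ne_zero hq _ _)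

end Closed

/-! ### Invariance under the inversion of the last rapidity -/

section Inversion

variable {q : ℂ} (hq : q ^ 2 + q + 1 = 0)

/-- `genInv L` fixes the rapidities of the sites `< L-1`. [folklore] -/
theorem genInv_zv_of_ne {j : Fin L} (hj : j.val + 1 ≠ L) : genInv ℂ L (zv j) = zv j := by
  unfold zv; rw [genInv_genZ, Function.update_of_ne hj]

/-- `genInv L` inverts the rapidity of the last site. [folklore] -/
theorem genInv_zv_last {j : Fin L} (hj : j.val + 1 = L) : genInv ℂ L (zv j) = (zv j)⁻¹ := by
  unfold zv; rw [genInv_genZ, hj, Function.update_self]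

include hq

/-- `c³ = 1`. [folklore] -/
theorem genC_pow_three : genC ℂ q ^ 3 = 1 := by
  have := genC_quad hq
  linear_combination (genC ℂ q - 1) * this

/-- **The prefactor pair is invariant under inverting one of its rapidities** (`q³ = 1`):
`[c u⁻¹/z][c² z u⁻¹] = [c u/z][c² z u]`. [cite: HagendorfLienardy2021, (3.27)] -/
theorem prefPair_inv (z u : RapidityField ℂ) :
    qbr (genC ℂ q * u⁻¹ / z) * qbr (genC ℂ q ^ 2 * z * u⁻¹) = qbr (genC ℂ q * u / z) * qbr (genC ℂ q ^ 2 * z * u) := by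
  have h3 := genC_pow_three hq
  have hcinv : (genC ℂ q)⁻¹ = genC ℂ q ^ 2 := inv_eq_of_mul_eq_one_right (by rw [← pow_succ']; exact h3)
  have hc2inv : (genC ℂ q ^ 2)⁻¹ = genC ℂ q := inv_eq_of_mul_eq_one_right (by rw [← pow_succ]; exact h3)
  have e1 : genC ℂ q * u⁻¹ / z = (genC ℂ q ^ 2 * z * u)⁻¹ := by rw [mul_inv, mul_inv, hc2inv]; ring
  have e2 : genC ℂ q ^ 2 * z * u⁻¹ = (genC ℂ q * u / z)⁻¹ := by rw [inv_div, div_eq_mul_inv, mul_inv, hcinv]; ring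
  rw [e1, e2, qbr_inv, qbr_inv]; ring

/-- **The special component with the last site up is invariant under `z_L ↦ 1/z_L`** (HL (3.27) at
`s = 1`). [cite: HagendorfLienardy2021, Prop. 3.7 (Case 1), (3.27)] -/
theorem genInv_vPsi_spec (h : n < L) :
    genInv ℂ L (vPsi q L n (Fin.castLE h.le)) = vPsi q L n (Fin.castLE h.le) := by
  have hL : 0 < L := by omega
  set u : Fin L := ⟨L - 1, by omega⟩ with hu
  have huL : u.val + 1 = L := by simp [hu]; omega
  have hfix : ∀ j : Fin L, j ≠ u → genInv ℂ L (zv j) = zv j := fun j hj =>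
    genInv_zv_of_ne fun h' => hj (Fin.ext (by simp [hu]; omega))
  rw [vPsi_spec hq h.le, map_mul]
  congr 1
  · -- the first factor does not involve `z_{L}`
    unfold specRHS
    have h1 : genInv ℂ L (∏ p ∈ (pairsLT L).filter (fun p => p.2.val < n),
        qbr (genC ℂ q * zv p.2 / zv p.1) * qbr (genC ℂ q * zv p.1 * zv p.2)) =
        ∏ p ∈ (pairsLT L).filter (fun p => p.2.val < n), qbr (genC ℂ q * zv p.2 / zv p.1) * qbr (genC ℂ q * zv p.1 * zv p.2) := by
      rw [map_prod]
      refine prod_congr rfl fun p hp => ?_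
      have hp2 : p.2.val < n := (mem_filter.1 hp).2
      have hp1 : p.1.val < n := lt_trans (Fin.lt_def.1 (mem_pairsLT.1 (mem_filter.1 hp).1)) hp2
      rw [map_mul, map_qbr, map_qbr, map_div₀, map_mul, map_mul, map_mul, genInv_genC,
        hfix p.1 (fun h' => by rw [h'] at hp1; simp [hu] at hp1; omega),
        hfix p.2 (fun h' => by rw [h'] at hp2; simp [hu] at hp2; omega)]
    have h2 : genInv ℂ L (∏ i ∈ sLT L n, (zv i)⁻¹) = ∏ i ∈ sLT L n, (zv i)⁻¹ := by
      rw [map_prod]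
      refine prod_congr rfl fun i hi => ?_
      rw [map_inv₀, hfix i (fun h' => by rw [h', mem_sLT] at hi; simp [hu] at hi; omega)]
    rw [map_mul, map_mul, map_pow, map_neg, map_one, h1, h2]
  · rw [map_prod]
    refine prod_congr rfl fun p hp => ?_
    have hlt : p.1 < p.2 := mem_pairsLT.1 (mem_filter.1 hp).1
    have hp1 : p.1 ≠ u := fun h' => by
      rw [h', Fin.lt_def] at hlt; simp [hu] at hlt; omega
    rw [map_mul, map_qbr, map_qbr, map_div₀, map_mul, map_mul, map_mul, map_pow, genInv_genC, hfix p.1 hp1]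
    by_cases hp2 : p.2 = u
    · rw [hp2, genInv_zv_last huL]
      exact prefPair_inv hq _ _
    · rw [hfix p.2 hp2]

end Inversion

end Literature.Probability.Percolation
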